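import Summits.ValiantsHypothesis.ValiantsHypothesis.Theses.LacunarySymmetroid
import Literature.Computability.AlgebraicComplexity.RealTauKnownCases
import Literature.Computability.Complexity.MCSPHardnessKabanetsCaiProofs

/-!
# Disproof of `ThetaWitness` (crux stmt-ValiantsHypothesis-18052, route `LacunarySymmetroid`) — findings

Standing work file of the crux DISPROVER (refuter-cdisprove-stmt-ValiantsHypothesis-18052-0,
cycle 1, 2026-08-17). Prose only in docstrings; everything below is `lean check`ed (rc 0, no sorry).

## Verdict (cycle 1): the crux RESISTS — it is TRUE, and (since 2026-08-17 ~06:20Z) PROVED in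
## the tree: `Theorems/LacunarySymmetroidThetaWitness.lean`, `thetaWitness_proof` @ c53605aacd50

`ThetaWitness := ∃ Θ d, IsVNPFamily (ℂ-map ∘ Θ) ∧ ∃ n₀, ∀ n ≥ n₀, 2^{n⌊log₂n⌋} ≤ Z(Θ,d,n) + 1`,
`Z` = number of distinct real zeros of `Θ_n(X^{d_{n,0}}, …, X^{d_{n,n-1}})`. It is an EXISTENCE claim
with no hypotheses, so there is nothing to make vacuous and a kill would be a universal real-zero
upper bound for VNP restrictions at rate `2^{n log n}` — hopeless, and false: a sorry-free candidate
proof is attached to the item (refuter-rattack, `LacunarySymmetroidThetaWitness.lean`, witness =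
Tavenas' bit polynomial `hV_{n⌊log₂n⌋}` under digit bundling `x_j ↦ y_{⌊j/L⌋}^{2^{j mod L}}`,
`d_{n,i} = 2^{iL}`, restriction `= tavenasV (nL)` with `2^{nL} - 1` real zeros by the tree theorem
`le_card_roots_toFinset_map_tavenasV`; three crux ideas re-derive it). Attacks run and why each fails:

* elaboration / read-back: rc 0, `Iff.rfl` against the def body (W.lean); quantifier order
  `∃Θ ∃d (VNP ∧ ∃n₀ ∀n≥n₀ …)` matches the informal text; `d` unconstrained by design.
* junk witnesses: the zero family has `Z = 0` (`roots 0 = ∅`, Mathlib) and fails the clause at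
  every `n ≥ 2` (`rootClause_fails_zero_family`); constant exponents `d = 0` give a constant
  restriction, `Z = 0` (`rootCount_exponents_zero`). No junk inhabitant earns roots.
* model check: the tree's `complexity` is Bürgisser's `L_k` with CONSTANTS FREE (`ofConst`,
  `size_ofConst = 0`) and NO formal-degree bound on circuits (only `IsPFamily`: #vars and
  `totalDegree` p-bounded) — Valiant's non-uniform model over `ℂ`. So the doubly-exponential
  constants `2^{2^l}` / `4^{2^{j+j'}}` of every witness line are legal; the constant-free subtlety of
  Koiran/Tavenas (`VNP⁰`, counting hierarchy) does not arise. `IsVNPFamily` over `ℂ` is non-junk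
  inhabited (`isVNPFamily_perPoly_holds ℂ`).
* the only obstruction on this side is Descartes' rule of signs; it is NOT binding at the crux's
  rate (§2–§4 quantify exactly where it would bind).

## Findings (negative knowledge every witness must respect) — all sorry-free below

1. `card_roots_restrict_le` (DESCARTES CEILING): `Z ≤ 2·#supp(Θ_n) - 1` for every `Θ, d`
   (restriction has ≤ #supp(Θ_n) monomials; a real t-nomial has ≤ 2t-1 distinct real zeros —
   tree `card_roots_toFinset_le_of_card_support`, Mathlib `roots_countP_pos_le_signVariations`).
   ⇒ a witness needs ≥ 2^{n⌊log₂n⌋-1} monomials at level n (the digit witness has exactly 2^{n⌊log₂n⌋}).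
2. `thetaWitness_false_with_small_digits` (DIGIT BASE FORCED, "false without high powers"): if
   eventually all individual degrees are `< 2^{⌊log₂n⌋-1}`, the clause fails (`#supp ≤ B^n`). The
   witness base `2^{⌊log₂n⌋}` is optimal within a factor 2. Corollary
   `thetaWitness_false_for_multilinear`: NO multilinear family (PER-like, HC, `hV`, `circuitSum`)
   can be `Θ` — powers must be substituted (all three idea cards do so; `replicate-and-project`
   does it by projection, fine).
3. `thetaWitness_false_without_lacunary_exponents` (LACUNARITY LOAD-BEARING): `deg Θ_n` and
   `max_i d_{n,i}` both `≤ n^c + c` ⇒ `Z ≤ (n^c+c)²` ⇒ clause fails. Any witness has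
   `max_i d_{n,i} · deg Θ_n ≥ 2^{n⌊log₂n⌋} - 1` (digit witness: `d_{n,n-1} = 2^{(n-1)L}`).
3b. `thetaWitness_false_with_subquadratic_degree` (TOTAL DEGREE Ω(n²) FORCED): eventually
   `16·deg Θ_n ≤ n²` ⇒ `#supp ≤ C(n + deg, n)` (`card_support_le_choose`) and
   `2·C(n + n²/16, n) < 2^{n⌊log₂n⌋}` for `n ≥ 12` (`two_mul_choose_lt_two_pow`,
   `C(n+D,n) ≤ (e(n+D)/n)^n ≤ (3(n+1)/8)^n ≤ (3/4)^n·2^{nL}`) ⇒ clause fails. The digit witness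
   has `deg Θ_n = n(2^L - 1) ∈ [n²/2 - n, n² - n]`: degree optimal within a factor ≤ 16.
4. `not_thetaWitness_rate_sq` (STRENGTHENING REFUTED): rate `2^{n²}` is impossible for every
   family of p-bounded degree (VNP or not): `Z + 1 ≤ 2(deg Θ_n + 1)^n = 2^{O(n log n)}`. The crux's
   rate is maximal up to the constant in the exponent; conversely rate `2^{c·n⌊log₂n⌋}` IS
   reachable for every fixed `c` (digits base `2^{cL}`, degree `< n^{c+1}`) — information for the
   planner (it would let `MatrixDescartes` be weakened to a single-constant `O(K log K)` door).
5. NOT attacked (out of scope / open): the `VP`-strengthening "some VP family has `2^{n⌊log₂n⌋}-1`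
   real zeros on a monomial curve". By the route's own `closes` argument it is equivalent to
   `¬(MatrixDescartes ∧ PencilTransfer)`; it is a real-τ-type open question (Chebyshev composition
   is not a Kronecker lift of a low-degree VP family in any known way). Recorded for the
   MatrixDescartes disprover, not pursued here (anti-leakage).

## Landing
Items 1–4 (incl. 3b) are filed as ONE negative-lemma proposal
`Theorems/ThetaWitness/Negative/DescartesCeiling.lean` (`--kind proof --supports
stmt-ValiantsHypothesis-18052`; namespace `…Theorems.ThetaWitness.Negative`, same theorem names).
This file keeps self-contained copies (namespace `…Cruxes.ThetaWitness.Disproof`) so that it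
elaborates before that proposal lands.

## Targets
None this cycle (payload `stuck_stubs = []`, no PICKED line, no registered skeleton).

## Near-misses
None: every statement attempted here is closed.
-/

-- `Summit.ValiantsHypothesis.ValiantsHypothesis.…` is the tree's mandated single-conjunct layout
-- (Sub = Summit), so the duplicated namespace component is intended.
set_option linter.dupNamespace false

noncomputable section

namespace Summit.ValiantsHypothesis.ValiantsHypothesis.Cruxes.ThetaWitness.Disproof

open Polynomial MvPolynomial Finset Real
open Literature.Computability.AlgebraicComplexity
open Summit.ValiantsHypothesis.ValiantsHypothesis.Theses.LacunarySymmetroid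

variable {n : ℕ}

/-! ### 1. The restriction to a monomial curve, monomial by monomial -/

/-- Expansion of the restriction `Θ(X^{d_0}, …, X^{d_{n-1}})` over the monomials of `Θ`: the
monomial `y^m` goes to `X^{∑ i, d_i m_i}`. [folklore] -/
theorem aeval_monomialCurve_eq_sum (Θ : MvPolynomial (Fin n) ℝ) (d : Fin n → ℕ) :
    MvPolynomial.aeval (fun i => (Polynomial.X : Polynomial ℝ) ^ d i) Θ =
      ∑ m ∈ Θ.support, Polynomial.C (Θ.coeff m) * Polynomial.X ^ (∑ i, d i * m i) := by
  conv_lhs => rw [Θ.as_sum]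
  rw [map_sum]
  refine Finset.sum_congr rfl fun m _ => ?_
  rw [MvPolynomial.aeval_monomial, Finsupp.prod_fintype _ _ (fun i => by simp)]
  simp only [← pow_mul, Finset.prod_pow_eq_pow_sum]
  rfl

/-- The restriction to a monomial curve has at most as many monomials as `Θ`. [folklore] -/
theorem card_support_restrict_le (Θ : MvPolynomial (Fin n) ℝ) (d : Fin n → ℕ) :
    (MvPolynomial.aeval (fun i => (Polynomial.X : Polynomial ℝ) ^ d i) Θ).support.card ≤
      Θ.support.card := by
  rw [aeval_monomialCurve_eq_sum]
  refine (card_support_sum_le _ _).trans ?_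
  refine (Finset.sum_le_sum (g := fun _ => 1) fun m _ => ?_).trans_eq ?_
  · exact Polynomial.card_support_C_mul_X_pow_le_one
  · simp

/-- The degree of the restriction is at most `(max_i d_i) · deg Θ`. [folklore] -/
theorem natDegree_restrict_le (Θ : MvPolynomial (Fin n) ℝ) (d : Fin n → ℕ) (D : ℕ)
    (hd : ∀ i, d i ≤ D) :
    (MvPolynomial.aeval (fun i => (Polynomial.X : Polynomial ℝ) ^ d i) Θ).natDegree ≤
      D * Θ.totalDegree := by
  rw [aeval_monomialCurve_eq_sum]
  refine Polynomial.natDegree_sum_le_of_forall_le _ _ fun m hm => ?_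
  refine (Polynomial.natDegree_C_mul_X_pow_le _ _).trans ?_
  have hdeg : ∑ i, m i ≤ Θ.totalDegree := by
    have h := MvPolynomial.le_totalDegree hm
    rwa [Finsupp.sum_fintype _ _ (fun _ => rfl)] at h
  calc ∑ i, d i * m i ≤ ∑ i, D * m i :=
        Finset.sum_le_sum fun i _ => Nat.mul_le_mul_right _ (hd i)
    _ = D * ∑ i, m i := (Finset.mul_sum _ _ _).symm
    _ ≤ D * Θ.totalDegree := Nat.mul_le_mul_left _ hdeg

/-! ### 2. The Descartes ceiling on the crux's quantity -/

/-- **Descartes ceiling.** For every `Θ` and `d`, the number `Z` of distinct real zeros of the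
restriction `Θ(X^{d_0}, …, X^{d_{n-1}})` satisfies `Z ≤ 2·#supp(Θ) - 1`: a real polynomial with `t`
monomials has at most `t - 1` positive, `t - 1` negative zeros and possibly `0`
(`card_roots_toFinset_le_of_card_support`, from Mathlib's rule of signs). [folklore] -/
theorem card_roots_restrict_le (Θ : MvPolynomial (Fin n) ℝ) (d : Fin n → ℕ) :
    (MvPolynomial.aeval (fun i => (Polynomial.X : Polynomial ℝ) ^ d i) Θ).roots.toFinset.card ≤
      2 * Θ.support.card - 1 := by
  by_cases h : MvPolynomial.aeval (fun i => (Polynomial.X : Polynomial ℝ) ^ d i) Θ = 0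
  · rw [h]
    simp
  · have h1 := card_roots_toFinset_le_of_card_support h
    have h2 := card_support_restrict_le Θ d
    have h3 : (MvPolynomial.aeval (fun i => (Polynomial.X : Polynomial ℝ) ^ d i) Θ).support.card ≠ 0 :=
      fun h0 => h (Polynomial.card_support_eq_zero.1 h0)
    omega

/-- A polynomial in `n` variables all of whose individual degrees are `< B` has at most `B^n`
monomials. [folklore] -/
theorem card_support_le_pow_of_degreeOf_lt (Θ : MvPolynomial (Fin n) ℝ) {B : ℕ}
    (hB : ∀ i, Θ.degreeOf i < B) : Θ.support.card ≤ B ^ n := by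
  classical
  calc Θ.support.card ≤ (Fintype.piFinset fun _ : Fin n => Finset.range B).card := by
        refine Finset.card_le_card_of_injOn (fun m : Fin n →₀ ℕ => (⇑m : Fin n → ℕ)) ?_ ?_
        · intro m hm
          rw [Finset.mem_coe, Fintype.mem_piFinset]
          intro i
          rw [Finset.mem_range]
          exact (MvPolynomial.monomial_le_degreeOf i hm).trans_lt (hB i)
        · intro m₁ _ m₂ _ h
          exact DFunLike.coe_injective h
    _ = B ^ n := by
        rw [Fintype.card_piFinset]
        simp

/-! ### 3. Load-bearing features of any witness -/

/-- **The digit base is forced.** No pair `(Θ, d)` whose individual degrees are eventually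
`< 2^{⌊log₂n⌋ - 1}` satisfies the root clause of `ThetaWitness`: then `#supp(Θ_n) ≤ 2^{n(⌊log₂n⌋-1)}`
and `Z + 1 ≤ 2^{n⌊log₂n⌋ - n + 1} < 2^{n⌊log₂n⌋}` for `n ≥ 2`. (No `VNP` hypothesis is needed; the
witness's base `2^{⌊log₂n⌋}` is optimal up to a factor `2`.) [folklore] -/
theorem thetaWitness_false_with_small_digits :
    ¬ ∃ (Θ : ∀ n : ℕ, MvPolynomial (Fin n) ℝ) (d : ∀ n : ℕ, Fin n → ℕ),
      (∃ n₁ : ℕ, ∀ n : ℕ, n₁ ≤ n → ∀ i, (Θ n).degreeOf i < 2 ^ (Nat.log 2 n - 1)) ∧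
      ∃ n₀ : ℕ, ∀ n : ℕ, n₀ ≤ n → 2 ^ (n * Nat.log 2 n) ≤
        (MvPolynomial.aeval (fun i => (Polynomial.X : Polynomial ℝ) ^ d n i) (Θ n)).roots.toFinset.card + 1 := by
  rintro ⟨Θ, d, ⟨n₁, h₁⟩, n₀, h₀⟩
  obtain ⟨n, hn₀, hn₁, hn2⟩ : ∃ n, n₀ ≤ n ∧ n₁ ≤ n ∧ 2 ≤ n := ⟨n₀ + n₁ + 2, by omega, by omega, by omega⟩
  have hZ := h₀ n hn₀
  have hsupp := card_support_le_pow_of_degreeOf_lt (Θ n) (h₁ n hn₁)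
  have hroots := card_roots_restrict_le (Θ n) (d n)
  rw [← pow_mul] at hsupp
  set L := Nat.log 2 n with hL
  have hL1 : 1 ≤ L := by
    rw [hL]
    calc 1 = Nat.log 2 2 := by decide
      _ ≤ Nat.log 2 n := Nat.log_mono_right hn2
  have hA : 2 ≤ 2 ^ (n * L) := by
    calc 2 = 2 ^ 1 := by norm_num
      _ ≤ 2 ^ (n * L) := Nat.pow_le_pow_right (by norm_num) ((Nat.mul_le_mul hn2 hL1).trans' (by norm_num))
  have key : 2 ^ (n * L) ≤ 2 ^ ((L - 1) * n + 1) := by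
    rw [pow_succ 2 ((L - 1) * n)]
    omega
  have key' := (Nat.pow_le_pow_iff_right (by norm_num : 1 < 2)).1 key
  have e : n * L = (L - 1) * n + n := by
    conv_lhs => rw [show L = (L - 1) + 1 by omega]
    ring
  omega

/-- **Multilinear families cannot witness `ThetaWitness`.** In particular the permanent-like,
Hamiltonian-cycle and bit-polynomial (`hV`, `circuitSum`) families of the tree are excluded as
`Θ` unless powers are substituted: for `n ≥ 4`, `1 < 2^{⌊log₂n⌋ - 1}`. [folklore] -/
theorem thetaWitness_false_for_multilinear :
    ¬ ∃ (Θ : ∀ n : ℕ, MvPolynomial (Fin n) ℝ) (d : ∀ n : ℕ, Fin n → ℕ),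
      (∀ n i, (Θ n).degreeOf i ≤ 1) ∧
      ∃ n₀ : ℕ, ∀ n : ℕ, n₀ ≤ n → 2 ^ (n * Nat.log 2 n) ≤
        (MvPolynomial.aeval (fun i => (Polynomial.X : Polynomial ℝ) ^ d n i) (Θ n)).roots.toFinset.card + 1 := by
  rintro ⟨Θ, d, hml, n₀, h₀⟩
  refine thetaWitness_false_with_small_digits ⟨Θ, d, ⟨4, fun n hn i => ?_⟩, n₀, h₀⟩
  have hL : 2 ≤ Nat.log 2 n :=
    calc 2 = Nat.log 2 4 := by decide
      _ ≤ Nat.log 2 n := Nat.log_mono_right hn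
  calc (Θ n).degreeOf i ≤ 1 := hml n i
    _ < 2 ^ 1 := by norm_num
    _ ≤ 2 ^ (Nat.log 2 n - 1) := Nat.pow_le_pow_right (by norm_num) (by omega)

/-- **Lacunary exponents are load-bearing.** If the degrees of `Θ_n` and the exponents `d_{n,i}` are
both p-bounded (`≤ n^c + c`), the restriction has degree `≤ (n^c + c)²`, hence at most that many
real zeros, and the root clause of `ThetaWitness` fails (checked at `n = 2^k`, `k = max (c+2) n₀ …`,
where `2^{nk} > 2^{2kc + 3} > (n^c + c)² + 1`). [folklore] -/
theorem thetaWitness_false_without_lacunary_exponents :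
    ¬ ∃ (Θ : ∀ n : ℕ, MvPolynomial (Fin n) ℝ) (d : ∀ n : ℕ, Fin n → ℕ),
      (∃ c : ℕ, ∀ n : ℕ, (Θ n).totalDegree ≤ n ^ c + c ∧ ∀ i, d n i ≤ n ^ c + c) ∧
      ∃ n₀ : ℕ, ∀ n : ℕ, n₀ ≤ n → 2 ^ (n * Nat.log 2 n) ≤
        (MvPolynomial.aeval (fun i => (Polynomial.X : Polynomial ℝ) ^ d n i) (Θ n)).roots.toFinset.card + 1 := by
  rintro ⟨Θ, d, ⟨c, hc⟩, n₀, h₀⟩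
  -- test level `n = 2^k`
  obtain ⟨k, hkc, hk₀, hk1⟩ : ∃ k, c + 2 ≤ k ∧ n₀ ≤ k ∧ 1 ≤ k := ⟨c + 2 + n₀, by omega, by omega, by omega⟩
  set n := 2 ^ k with hn
  have hkn : k < n := Nat.lt_two_pow_self
  have hL : Nat.log 2 n = k := by rw [hn, Nat.log_pow (by norm_num)]
  have hZ := h₀ n (by omega)
  rw [hL] at hZ
  -- `Z ≤ deg ≤ (n^c + c) * (n^c + c)`
  have hdeg := natDegree_restrict_le (Θ n) (d n) (n ^ c + c) (hc n).2
  have hroots : (MvPolynomial.aeval (fun i => (Polynomial.X : Polynomial ℝ) ^ d n i) (Θ n)).roots.toFinset.card ≤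
      (n ^ c + c) * (n ^ c + c) :=
    ((Multiset.toFinset_card_le _).trans (Polynomial.card_roots' _)).trans
      (hdeg.trans (Nat.mul_le_mul_left _ (hc n).1))
  -- `n^c + c ≤ 2^(kc+1)`
  have hc2 : c < 2 ^ c := Nat.lt_two_pow_self
  have hM : n ^ c + c ≤ 2 ^ (k * c + 1) := by
    rw [hn, ← pow_mul, pow_succ]
    have : 2 ^ c ≤ 2 ^ (k * c) := Nat.pow_le_pow_right (by norm_num) (by nlinarith)
    omega
  -- so `2^(nk) ≤ 2^(2kc+2) + 1 ≤ 2^(2kc+3)`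
  have h3 : 2 ^ (n * k) ≤ 2 ^ (2 * (k * c) + 3) := by
    have hsq : (n ^ c + c) * (n ^ c + c) ≤ 2 ^ (k * c + 1) * 2 ^ (k * c + 1) :=
      Nat.mul_le_mul hM hM
    rw [← pow_add] at hsq
    have e : k * c + 1 + (k * c + 1) = 2 * (k * c) + 2 := by ring
    rw [e] at hsq
    have hpos : 1 ≤ 2 ^ (2 * (k * c) + 2) := Nat.one_le_two_pow
    have h3' : 2 ^ (n * k) ≤ 2 ^ (2 * (k * c) + 2) + 1 := by omega
    calc 2 ^ (n * k) ≤ 2 ^ (2 * (k * c) + 2) + 1 := h3'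
      _ ≤ 2 ^ (2 * (k * c) + 2) + 2 ^ (2 * (k * c) + 2) := by omega
      _ = 2 ^ (2 * (k * c) + 3) := by ring
  have h4 := (Nat.pow_le_pow_iff_right (by norm_num : 1 < 2)).1 h3
  -- but `n ≥ 2^(c+2) ≥ 4(c+1)`, so `nk ≥ 4ck + 4k ≥ 2kc + 3`
  have hn4 : 4 * (c + 1) ≤ n := by
    calc 4 * (c + 1) ≤ 4 * 2 ^ c := by omega
      _ = 2 ^ (c + 2) := by ring
      _ ≤ 2 ^ k := Nat.pow_le_pow_right (by norm_num) hkc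
  have h5 : 4 * (c + 1) * k ≤ n * k := Nat.mul_le_mul_right k hn4
  have e1 : 4 * (c + 1) * k = 4 * (k * c) + 4 * k := by ring
  rw [e1] at h5
  omega

/-! ### 4. The rate is maximal: the `2^{n²}` strengthening is false for p-bounded degree -/

/-- **The rate cannot be strengthened to `2^{n²}`.** For every family of p-bounded total degree
(in particular every p-family, `VNP` or not) and all exponents `d`, the restriction to a monomial
curve has `Z + 1 ≤ 2·(deg Θ_n + 1)^n = 2^{O(n log n)}` distinct real zeros, so
"eventually `2^{n²} ≤ Z + 1`" fails (checked at `n = 2^k`, using `k² ≤ 2^k`, tree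
`KabanetsCai.sq_le_two_pow`). The crux's rate `2^{n⌊log₂n⌋}` is thus maximal up to the constant in
the exponent. [folklore] -/
theorem not_thetaWitness_rate_sq :
    ¬ ∃ (Θ : ∀ n : ℕ, MvPolynomial (Fin n) ℝ) (d : ∀ n : ℕ, Fin n → ℕ),
      (∃ c : ℕ, ∀ n : ℕ, (Θ n).totalDegree ≤ n ^ c + c) ∧
      ∃ n₀ : ℕ, ∀ n : ℕ, n₀ ≤ n → 2 ^ (n ^ 2) ≤
        (MvPolynomial.aeval (fun i => (Polynomial.X : Polynomial ℝ) ^ d n i) (Θ n)).roots.toFinset.card + 1 := by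
  rintro ⟨Θ, d, ⟨c, hc⟩, n₀, h₀⟩
  obtain ⟨k, hkc, hk₀, hk4⟩ : ∃ k, c + 2 ≤ k ∧ n₀ ≤ k ∧ 4 ≤ k := ⟨c + n₀ + 4, by omega, by omega, by omega⟩
  set n := 2 ^ k with hn
  have hkn : k < n := Nat.lt_two_pow_self
  have hZ := h₀ n (by omega)
  -- individual degrees `< B := 2^(kc+1)`
  have hc2 : c < 2 ^ c := Nat.lt_two_pow_self
  have hB : ∀ i, (Θ n).degreeOf i < 2 ^ (k * c + 1) := by
    intro i
    have h1 : (Θ n).degreeOf i ≤ n ^ c + c :=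
      (MvPolynomial.degreeOf_le_totalDegree _ _).trans (hc n)
    have h2 : n ^ c + c < 2 ^ (k * c + 1) := by
      rw [hn, ← pow_mul, pow_succ]
      have : 2 ^ c ≤ 2 ^ (k * c) := Nat.pow_le_pow_right (by norm_num) (by nlinarith)
      omega
    exact h1.trans_lt h2
  have hsupp := card_support_le_pow_of_degreeOf_lt (Θ n) hB
  rw [← pow_mul] at hsupp
  have hroots := card_roots_restrict_le (Θ n) (d n)
  -- `2^(n²) ≤ Z + 1 ≤ 2·2^((kc+1)n) = 2^((kc+1)n+1)`
  have hA : 2 ≤ 2 ^ (n ^ 2) := by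
    calc 2 = 2 ^ 1 := by norm_num
      _ ≤ 2 ^ (n ^ 2) := Nat.pow_le_pow_right (by norm_num) (Nat.one_le_pow _ _ (by omega))
  have key : 2 ^ (n ^ 2) ≤ 2 ^ ((k * c + 1) * n + 1) := by
    rw [pow_succ 2 ((k * c + 1) * n)]
    omega
  have key' := (Nat.pow_le_pow_iff_right (by norm_num : 1 < 2)).1 key
  -- but `n = 2^k ≥ k² ≥ k(c+2)`, so `n ≥ kc + 2` and `n² ≥ (kc+2)n > (kc+1)n + 1`
  have hnk : k * c + 2 ≤ n := by
    have h1 : k * k ≤ n := Literature.Computability.Complexity.KabanetsCai.sq_le_two_pow hk4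
    have h2 : k * (c + 2) ≤ k * k := Nat.mul_le_mul_left k hkc
    have e2 : k * (c + 2) = k * c + 2 * k := by ring
    omega
  have h6 : (k * c + 2) * n ≤ n ^ 2 := by
    rw [sq]
    exact Nat.mul_le_mul_right n hnk
  nlinarith

/-! ### 5. Total degree `Ω(n²)` is necessary -/

/-- Monomial count: a polynomial in `n` variables of total degree `D` has at most `C(n + D, n)`
monomials (pad a monomial of degree `≤ D` by a slack variable to degree exactly `D` in `n + 1`
variables; stars and bars, Mathlib `Finset.card_finsuppAntidiag_nat_eq_choose`). [folklore] -/
theorem card_support_le_choose (Θ : MvPolynomial (Fin n) ℝ) :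
    Θ.support.card ≤ (n + Θ.totalDegree).choose n := by
  classical
  set D := Θ.totalDegree with hD
  let pad : (Fin n →₀ ℕ) → (Fin (n + 1) →₀ ℕ) := fun m =>
    Finsupp.equivFunOnFinite.symm (Fin.snoc (⇑m) (D - ∑ i, m i))
  have hpad_castSucc : ∀ (m : Fin n →₀ ℕ) (i : Fin n), pad m (Fin.castSucc i) = m i := by
    intro m i
    simp [pad]
  have hpad_last : ∀ m : Fin n →₀ ℕ, pad m (Fin.last n) = D - ∑ i, m i := by
    intro m
    simp [pad]
  calc Θ.support.card ≤ ((Finset.univ : Finset (Fin (n + 1))).finsuppAntidiag D).card := by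
        refine Finset.card_le_card_of_injOn pad ?_ ?_
        · intro m hm
          rw [Finset.mem_coe, Finset.mem_finsuppAntidiag]
          refine ⟨?_, Finset.subset_univ _⟩
          rw [Fin.sum_univ_castSucc]
          simp only [hpad_castSucc, hpad_last]
          have hdeg : ∑ i, m i ≤ D := by
            have h := MvPolynomial.le_totalDegree hm
            rwa [Finsupp.sum_fintype _ _ (fun _ => rfl)] at h
          omega
        · intro m₁ _ m₂ _ h
          ext i
          have hi := congrArg (fun f : Fin (n + 1) →₀ ℕ => f (Fin.castSucc i)) h
          simpa only [hpad_castSucc] using hi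
    _ = (n + D).choose n := by
        rw [Finset.card_finsuppAntidiag_nat_eq_choose, Finset.card_univ, Fintype.card_fin,
          show n + 1 + D - 1 = n + D by omega]
        exact (Nat.choose_symm_add (a := n) (b := D)).symm

/-- The binomial estimate behind the quadratic-degree necessity: for `n ≥ 12` and `16 D ≤ n²`,
`2 · C(n + D, n) < 2^{n⌊log₂ n⌋}` (`C(n+D,n) ≤ (e(n+D)/n)^n ≤ (3(n+1)/8)^n ≤ (3/4)^n 2^{n⌊log₂n⌋}`).
[folklore] -/
theorem two_mul_choose_lt_two_pow {n D : ℕ} (hn : 12 ≤ n) (hD : 16 * D ≤ n ^ 2) :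
    2 * (n + D).choose n < 2 ^ (n * Nat.log 2 n) := by
  set L := Nat.log 2 n with hL
  have hnL : n + 1 ≤ 2 ^ (L + 1) := Nat.lt_pow_succ_log_self (by norm_num) n
  -- work in `ℝ`
  have hnpos : (0 : ℝ) < n := by exact_mod_cast (show 0 < n by omega)
  have hn12 : (12 : ℝ) ≤ n := by exact_mod_cast hn
  have hepos : (0 : ℝ) < exp 1 := exp_pos 1
  have he : exp 1 < 2.7182818286 := Real.exp_one_lt_d9
  have hbase_pos : (0 : ℝ) < (n : ℝ) / exp 1 := div_pos hnpos hepos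
  -- `C ≤ (n+D)^n / n! ≤ ((n+D) / (n/e))^n`
  have hC : (((n + D).choose n : ℕ) : ℝ) ≤ (((n + D : ℕ) : ℝ)) ^ n / n.factorial := by
    have h := Nat.choose_le_pow_div (α := ℝ) n (n + D)
    exact_mod_cast h
  have hC2 : (((n + D).choose n : ℕ) : ℝ) ≤ (((n + D : ℕ) : ℝ) / ((n : ℝ) / exp 1)) ^ n := by
    rw [div_pow]
    have hfact : ((n : ℝ) / exp 1) ^ n ≤ (n.factorial : ℝ) := by
      -- `(n/e)^n ≤ n!` from `n^n / n! ≤ e^n` (Mathlib `Real.pow_div_factorial_le_exp`)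
      have h := Real.pow_div_factorial_le_exp (x := (n : ℝ)) (Nat.cast_nonneg n) n
      rw [div_le_iff₀ (by positivity)] at h
      rw [div_pow, div_le_iff₀ (by positivity), ← Real.exp_nat_mul, mul_one, mul_comm]
      exact h
    exact hC.trans (div_le_div_of_nonneg_left (by positivity) (pow_pos hbase_pos n) hfact)
  -- the base: `(n + D) e / n ≤ 3(n+1)/8`
  have hDR : 16 * (D : ℝ) ≤ (n : ℝ) ^ 2 := by exact_mod_cast hD
  have hbase : ((n + D : ℕ) : ℝ) / ((n : ℝ) / exp 1) ≤ 3 / 8 * ((n : ℝ) + 1) := by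
    rw [div_le_iff₀ hbase_pos]
    push_cast
    -- `n + D ≤ 3/8 (n+1) · n / e`, i.e. `(n + D) e ≤ 3/8 (n+1) n`
    rw [mul_div_assoc', le_div_iff₀ hepos]
    have h1 : (D : ℝ) * exp 1 ≤ (n : ℝ) ^ 2 / 16 * exp 1 :=
      mul_le_mul_of_nonneg_right (by linarith) hepos.le
    have h2 : exp 1 * (16 + (n : ℝ)) ≤ 6 * ((n : ℝ) + 1) := by
      have h3 : exp 1 * (16 + (n : ℝ)) ≤ 2.7182818286 * (16 + (n : ℝ)) :=
        mul_le_mul_of_nonneg_right he.le (by linarith)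
      nlinarith
    have h4 : ((n : ℝ) + D) * exp 1 ≤ (n : ℝ) * (exp 1 * (16 + n)) / 16 := by nlinarith
    have h5 : (n : ℝ) * (exp 1 * (16 + n)) / 16 ≤ (n : ℝ) * (6 * (n + 1)) / 16 := by
      have := mul_le_mul_of_nonneg_left h2 hnpos.le
      linarith
    calc ((n : ℝ) + D) * exp 1 ≤ (n : ℝ) * (6 * (n + 1)) / 16 := h4.trans h5
      _ = 3 / 8 * ((n : ℝ) + 1) * n := by ring
  -- `3/8 (n+1) ≤ 3/4 · 2^L`
  have h2L : ((n : ℝ) + 1) / 2 ≤ (2 : ℝ) ^ L := by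
    have h : ((n : ℝ) + 1) ≤ (2 : ℝ) ^ (L + 1) := by exact_mod_cast hnL
    rw [pow_succ] at h
    linarith
  have hbase2 : ((n + D : ℕ) : ℝ) / ((n : ℝ) / exp 1) ≤ 3 / 4 * (2 : ℝ) ^ L := by
    calc ((n + D : ℕ) : ℝ) / ((n : ℝ) / exp 1) ≤ 3 / 8 * ((n : ℝ) + 1) := hbase
      _ = 3 / 4 * (((n : ℝ) + 1) / 2) := by ring
      _ ≤ 3 / 4 * (2 : ℝ) ^ L := by linarith
  have hbase_nonneg : (0 : ℝ) ≤ ((n + D : ℕ) : ℝ) / ((n : ℝ) / exp 1) := by positivity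
  have hC3 : (((n + D).choose n : ℕ) : ℝ) ≤ (3 / 4) ^ n * (2 : ℝ) ^ (n * L) := by
    calc (((n + D).choose n : ℕ) : ℝ) ≤ (((n + D : ℕ) : ℝ) / ((n : ℝ) / exp 1)) ^ n := hC2
      _ ≤ (3 / 4 * (2 : ℝ) ^ L) ^ n := pow_le_pow_left₀ hbase_nonneg hbase2 n
      _ = (3 / 4) ^ n * (2 : ℝ) ^ (n * L) := by rw [mul_pow, ← pow_mul, mul_comm L n]
  -- `(3/4)^n ≤ (3/4)^3 = 27/64`, so `2 C ≤ 27/32 · 2^{nL} < 2^{nL}`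
  have h34 : (3 / 4 : ℝ) ^ n ≤ (3 / 4) ^ 3 :=
    pow_le_pow_of_le_one (by norm_num) (by norm_num) (by omega)
  have hpow_pos : (0 : ℝ) < (2 : ℝ) ^ (n * L) := by positivity
  have hfin : (2 : ℝ) * ((n + D).choose n : ℕ) < (2 : ℝ) ^ (n * L) := by
    have := mul_le_mul_of_nonneg_right h34 hpow_pos.le
    nlinarith
  exact_mod_cast hfin

/-- **Total degree `Ω(n²)` is necessary for `ThetaWitness`.** No pair `(Θ, d)` with eventually
`16 · deg Θ_n ≤ n²` satisfies the root clause: `Z + 1 ≤ 2·#supp(Θ_n) ≤ 2·C(n + deg Θ_n, n) <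
2^{n⌊log₂n⌋}` for `n ≥ 12`. The digit-bundled Tavenas witness has `deg Θ_n = n(2^{⌊log₂n⌋} - 1) ∈
[n²/2 - n, n² - n]`, so its degree is optimal up to a constant factor `≤ 16`. (No `VNP` hypothesis.)
[folklore] -/
theorem thetaWitness_false_with_subquadratic_degree :
    ¬ ∃ (Θ : ∀ n : ℕ, MvPolynomial (Fin n) ℝ) (d : ∀ n : ℕ, Fin n → ℕ),
      (∃ n₁ : ℕ, ∀ n : ℕ, n₁ ≤ n → 16 * (Θ n).totalDegree ≤ n ^ 2) ∧
      ∃ n₀ : ℕ, ∀ n : ℕ, n₀ ≤ n → 2 ^ (n * Nat.log 2 n) ≤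
        (MvPolynomial.aeval (fun i => (Polynomial.X : Polynomial ℝ) ^ d n i) (Θ n)).roots.toFinset.card + 1 := by
  rintro ⟨Θ, d, ⟨n₁, h₁⟩, n₀, h₀⟩
  obtain ⟨n, hn₀, hn₁, hn⟩ : ∃ n, n₀ ≤ n ∧ n₁ ≤ n ∧ 12 ≤ n :=
    ⟨n₀ + n₁ + 12, by omega, by omega, by omega⟩
  have hZ := h₀ n hn₀
  have hroots := card_roots_restrict_le (Θ n) (d n)
  have hsupp := card_support_le_choose (Θ n)
  have hlt := two_mul_choose_lt_two_pow hn (h₁ n hn₁)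
  have hL1 : 1 ≤ Nat.log 2 n :=
    calc 1 = Nat.log 2 2 := by decide
      _ ≤ Nat.log 2 n := Nat.log_mono_right (by omega)
  have hA : 2 ≤ 2 ^ (n * Nat.log 2 n) :=
    calc 2 = 2 ^ 1 := by norm_num
      _ ≤ 2 ^ (n * Nat.log 2 n) :=
        Nat.pow_le_pow_right (by norm_num) ((Nat.mul_le_mul (by omega : 2 ≤ n) hL1).trans' (by norm_num))
  omega

/-! ### 6. Junk guards: degenerate witnesses earn no roots -/

/-- The zero family has no real zeros on any monomial curve (`roots 0 = ∅` in Mathlib). [folklore] -/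
theorem rootCount_zero_family (n : ℕ) (d : Fin n → ℕ) :
    (MvPolynomial.aeval (fun i => (Polynomial.X : Polynomial ℝ) ^ d i)
      (0 : MvPolynomial (Fin n) ℝ)).roots.toFinset.card = 0 := by
  simp

/-- Hence the root clause of `ThetaWitness` fails for the zero family at every level `n ≥ 2`
(so `Θ = 0`, which IS a `VNP` family, is not a junk witness). [folklore] -/
theorem rootClause_fails_zero_family (n : ℕ) (hn : 2 ≤ n) (d : Fin n → ℕ) :
    ¬ 2 ^ (n * Nat.log 2 n) ≤ (MvPolynomial.aeval (fun i => (Polynomial.X : Polynomial ℝ) ^ d i)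
      (0 : MvPolynomial (Fin n) ℝ)).roots.toFinset.card + 1 := by
  rw [rootCount_zero_family]
  have hL : 1 ≤ Nat.log 2 n :=
    calc 1 = Nat.log 2 2 := by decide
      _ ≤ Nat.log 2 n := Nat.log_mono_right hn
  have h2 : 2 ≤ 2 ^ (n * Nat.log 2 n) :=
    calc 2 = 2 ^ 1 := by norm_num
      _ ≤ 2 ^ (n * Nat.log 2 n) :=
        Nat.pow_le_pow_right (by norm_num) ((Nat.mul_le_mul hn hL).trans' (by norm_num))
  omega

/-- Constant exponents `d = 0` give a constant restriction: no real zeros at all. [folklore] -/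
theorem rootCount_exponents_zero (Θ : MvPolynomial (Fin n) ℝ) (d : Fin n → ℕ) (hd : ∀ i, d i = 0) :
    (MvPolynomial.aeval (fun i => (Polynomial.X : Polynomial ℝ) ^ d i) Θ).roots.toFinset.card = 0 := by
  have h := natDegree_restrict_le Θ d 0 (fun i => (hd i).le)
  rw [zero_mul, Nat.le_zero] at h
  have h' := (Multiset.toFinset_card_le _).trans
    (Polynomial.card_roots' (MvPolynomial.aeval (fun i => (Polynomial.X : Polynomial ℝ) ^ d i) Θ))
  omega

/-! ### 7. The crux itself, for reference (NOT proved here: positive landings are the provers') -/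

/-- Shape check only: the four negative theorems above speak about the literal root clause of the
route decl. [folklore] -/
example : ThetaWitness ↔
    ∃ (Θ : ∀ n : ℕ, MvPolynomial (Fin n) ℝ) (d : ∀ n : ℕ, Fin n → ℕ),
      IsVNPFamily (fun n => MvPolynomial.map (algebraMap ℝ ℂ) (Θ n)) ∧
      ∃ n₀ : ℕ, ∀ n : ℕ, n₀ ≤ n → 2 ^ (n * Nat.log 2 n) ≤
        (MvPolynomial.aeval (fun i => (Polynomial.X : Polynomial ℝ) ^ d n i) (Θ n)).roots.toFinset.card + 1 :=
  Iff.rfl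

end Summit.ValiantsHypothesis.ValiantsHypothesis.Cruxes.ThetaWitness.Disproof

end
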